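import Summits.BirchSwinnertonDyer.Rank1Residual.X11b.RouteR1BDPValueRecord
import Summits.BirchSwinnertonDyer.Rank1Residual.X11b.RouteOpenInputsAgree
import HarnessLib

/-!
# X11b, route p2 at `p ≥ 5` — the PUB half of ITS open input (Cas18 Thm. 3.2) DISCHARGED FROM PRINT
# by the same fact: on SEMISTABLE pairs `P2OpenInputOnTreeAt W p` follows from the ONE-SIDED main
# conjecture divisibility (2.4) `Ch_Λ(X_ac)·Λ_{R₀} ⊆ (L_p(f))` for Castella's published `L_p(f)`

HONEST FRAMING (cell `b2b-bsdres`, run/shared/lean/b2b/bsd-rank1-residual/, verbatim in every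
file): the goal of the cell is to DELETE the COMBINATION-SHAPED residual classes of the
Birch–Swinnerton-Dyer formula for ALL analytic-rank `≤ 1` elliptic curves over `ℚ` — "full BSD
formula for every rank `≤ 1` curve in class `C`" assembled STRICTLY from published theorems — so
that the rank-`≤ 1` remainder becomes exactly the CONSTRUCTION-SHAPED classes, which are TYPED
(missing-input `Prop`s), NOT attempted. This is not "finishing BSD". Written by sub-cell
`b2b-bsdres-multr1-p1` (route R1, gen 21) FOR sub-cell `b2b-bsdres-multr1-p2` (route p2, owner of the
`X11b.P2.…` records; handed over by name, the owner may re-home / rename); a RESEARCH ROUTE; no claim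
beyond the stated class; X11b stays CONSTRUCTION-SHAPED; nothing here changes a label; ONE
`Prop`-valued class-level SHAPE with a body (OPEN, claim-tagged, never a theorem) and theorems; the
PUBLISHED fact `Castella2018.thm32_exists_isBDPLFunction_valueAtOne` (Cas18 Thms. 3.1–3.2) enters as
the hypothesis `h32`; every result using the OPEN shape is CONDITIONAL; no `sorry`. Treaty with team
x11b3 (OWNERS A6.3 (2)): `p ≥ 5`; x11b3's `Three.IMCDivAt₃` (the `p = 3` twin) is neither imported
nor restated.

## What this file does

Route p2's ONE open input `P2OpenInputOnTreeAt W p` (multr1-p2, `BDPRouteRecord.lean`) is the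
ONE-SIDED composite (IMC≥)∘(BDP) at `𝟙`: `2·(ord_p log_{ω_E} P − 1) ≤ ord_p f_ac(0)` at every
classical Heegner datum — "erratum (2.4) `Ch_Λ(X_ac(E[p^∞])) ⊆ (L_p(f))` [display transcribed to
classical data; NO announced derivation there, see the status notes under §2 below (gen 29)] composed
with Cas18 Thm. 3.2 [PUB]". With Cas18 Thms. 3.1–3.2 in the tree as ONE
published fact (gen 21, `Literature/…/Castella2018/PAdicWaldspurgerFormula.lean`), the PUB half
separates off exactly as on route R1 (`RouteR1BDPValue.lean`):

* §1 `imcLowerWaldspurgerOnTreeAt_of_padicLogOrd_eq` — transport of the one-sided link along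
  `P ↦ τ_* P` when the logarithm orders agree; `mordellWeilRank_baseChange_eq_one_of_twist_ne_zero` —
  `rank_ℤ E(K) = 1` for `K` imaginary quadratic with `L(E^{d_K},1) ≠ 0` and `ord_{s=1} L(E,s) = 1`
  (GZK over `ℚ` twice + modularity; no Heegner hypothesis), the input of the log-order symmetry.
* §2 **`P2.IMCDivOnTree W p`** — THE OPEN HALF of route p2 at `p ≥ 5`, typed over Castella's frame:
  at every datum of `P2OpenInputOnTreeAt`, every newform `f` of `E`, every embedding datum `ι'`,
  infinite place `w₀` and frame `(Ω_K, Ω_p, L)` with `IsBDPLFunction ι' 𝔭_{ι'} κ γ f Ω_K Ω_p L`: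
  `Ch_Λ(X_ac^∅(E[p^∞]))·R₀⟦T⟧ ⊆ (L)` (erratum (2.4); x11b3's `IMCDivAt₃` is the `p = 3` twin). A
  predicate; NEVER a theorem. STATUS NOTES OF THE OWNER (multr1-p2, gen 29; doc + tag only, body
  byte-identical): (i) REFUTED AS STATED — gen 26's `P2.not_imcDivOnTree_of_facts`
  (`X11b/BDPRouteOpenInputDegenerateFrame.lean`): without a binder `Ω_K ≠ 0` the degenerate frame
  `(Ω_K, L) = (0, 0)` has the interpolation property vacuously while `Ch_Λ(X_ac) ⊄ (0)`; the CORRECTED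
  ∀-shape is `P2.IMCDivAllUnrFramesOnTree` (`X11b/BDPRouteOpenInputDescent.lean`) and the open
  statement of record is (2.4)∃♭ `P2.IMCDivSomeFrameOnTree[AtField]`; this def is kept in place because
  its consumers compile (their `P2.IMCDivOnTree` hypothesis is now vacuously strong) and nothing of
  record rests on it; (ii) SCOPE — like every classical-field `P2.` shape it lives at CLASSICAL Heegner
  data (every `ℓ ∣ N_E` split in `K`), whereas the erratum's "(2.4) … By [FW21, Thm. 4.41]" carries
  Fouquet–Wan's hypothesis "there exists `q ∥ N` … not split in `K`" (arXiv:2107.13726v3 Thm. 4.41,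
  third hypothesis; so [Castella2018, p. 4] and [Castella2024, Thm. 3.1 (iii)]) — that derivation lives
  at route R1's ERRATUM fields (`P2.IMCDivIntFrameAtErratumData`, gen 28) and NO derivation is
  announced at classical data (at classical fields print has [BurungaleCastellaSkinner2025, Thm. 1.2.4]
  for GOOD ORDINARY `p` only, and at `p ∥ N` only STEP L, [SkinnerZhang2014] Thm. 1.2, PREPRINT); the
  claim badge naming the erratum is therefore withdrawn (cite-only).
* §3 **`P2.openInputOnTreeAt_of_imcDiv`** — on a SEMISTABLE pair: `h32` (Cas18 Thms. 3.1–3.2) +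
  `hnf` + `hGZK` + the control identity `P2ControlOnTreeAt W p` (a THEOREM on the Locus: x11b3-p9's
  `p2ControlOnTreeAt_of_locus`) + `P2.IMCDivOnTree W p` ⟹ `P2OpenInputOnTreeAt W p`. Per datum: the
  prime `𝔭 = 𝔭_{ι'}` for `ι' ∈ {ι₀, ι₀ ∘ conj}` (`eq_primeOfEmbeddingDatum_or_eq_trans_starRingAut`);
  the datum's complex embedding is `w₀.embedding ∘ τ`, `τ ∈ Gal(K/ℚ)`, so `τ_* P` is the Heegner point
  in the fact's reading; `embAt K p 𝔭` induces `𝔭`; the fact gives a frame and the value at `𝟙` for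
  `τ_* P` (`R1.exists_frame_bdpValueAtOneOnTreeAt_of_satisfiesHeegnerHypothesis`), `P2.IMCDivOnTree`
  the divisibility at that frame, CTL₀ comes from the control identity, the pointwise assembly is
  team x11b3's `Halves.imcLowerWaldspurgerOnTreeAt_of_value_of_dvd`, and finally
  `ord_p log(τ_* P) = ord_p log P` (`rank_ℤ E(K) = 1`, `τ² = 1`).
* §4 **`P2.bsdp_of_imcDiv_of_locus`** — record for the owner: `BSD_p` on SEMISTABLE Locus pairs
  (`X11b ∧ p ≥ 5 ∧ (ram) ∧ p ∤ ∏_ℓ c_ℓ(E)`) from the PUBLISHED facts of multr1-p2's tightness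
  `P2.openInputOnTreeAt_iff_bsdp_of_locus` (GZ, Kolyvagin ×2, Skinner Thm. C, Wuthrich, GZK, modularity,
  Hoffstein–Luo, Mazur) + `h32`, the CITED cohomological facts (`hPTs hPT hPT2 hEP hcd`), and ONE OPEN
  input `P2.IMCDivOnTree W p` — the divisibility (2.4), which is LITERALLY the display the erratum takes
  from [FW21, Thm. 4.41] ("By [FW21, Thm. 4.41], we then have the divisibility (2.4)", erratum p. 4) —
  at the erratum's fields (a prime `q ∥ N` non-split in `K`), NOT at these classical data (gen-29
  status notes under §2); one step closer to the preprint's SHAPE than route R1's equality.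

CONDITIONAL on the open half; deletes nothing; X11b stays CONSTRUCTION-SHAPED; no label change.

References: [Castella2018] p. 4, Thm. 2.3, Thm. 3.1, (3.2), Thm. 3.2, §5 (arXiv:1704.06608 pp. 5, 9,
12); [Castella2018Erratum] (2.4), Thm. 1.1 (pp. 1, 4); [FouquetWan2021] Thm. 4.41 (arXiv:2107.13726v3
p. 44; PREPRINT); [Castella2024] Thm. 3.1 (PREPRINT); [BurungaleCastellaSkinner2025] Thm. 1.2.4;
[SkinnerZhang2014] Thm. 1.2 (PREPRINT); [CastellaHsieh2018] §3.3.
-/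

noncomputable section

open scoped Classical

open WeierstrassCurve NumberField IsDedekindDomain Field PowerSeries
open Literature.NumberTheory.EllipticCurves Literature.NumberTheory.EllipticCurves.GreenbergSelmer
open Literature.NumberTheory.EllipticCurves.ModularForms
open Literature.NumberTheory.EllipticCurves.Rank1Residual
open Literature.NumberTheory.EllipticCurves.Rank1Residual.Typed
open Literature.NumberTheory.EllipticCurves.Wuthrich2014
open Literature.NumberTheory.EllipticCurves.Castella2018
open Literature.NumberTheory.GaloisRepresentations
open Literature.NumberTheory.GaloisCohomology
open Summit.BirchSwinnertonDyer.Rank1Residual.X11b.AcSelmer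
open Summit.BirchSwinnertonDyer.Rank1Residual.X11b.Halves

namespace Summit.BirchSwinnertonDyer.Rank1Residual.X11b

/-! ### §1 Two bridges -/

section Bridges

variable (W : WeierstrassCurve ℚ) [W.IsElliptic] [W.IsGloballyMinimal] (p : ℕ) [Fact p.Prime]
  {K : Type} [Field K] [NumberField K]

/-- Transport of route p2's one-sided link along `P ↦ P'` when the two logarithm orders agree.
[folklore] -/
theorem imcLowerWaldspurgerOnTreeAt_of_padicLogOrd_eq (ι : K →+* ℚ_[p])
    {κ : ZpExtension K p} {𝔭 : HeightOneSpectrum (𝓞 K)} {γ : Field.absoluteGaloisGroup K}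
    [Fact (κ.IsTopGenerator γ)] {P P' : (W.baseChange K).toAffine.Point}
    (hlog : padicLogOrd W p ι P' = padicLogOrd W p ι P)
    (h : IMCLowerWaldspurgerOnTreeAt p κ 𝔭 γ ι P') : IMCLowerWaldspurgerOnTreeAt p κ 𝔭 γ ι P := by
  obtain ⟨n, hn, hle⟩ := h
  exact ⟨n, hn, by rw [← hlog]; exact hle⟩

omit [W.IsGloballyMinimal] in
/-- **`rank_ℤ E(K) = 1` over an imaginary quadratic `K` with `L(E^{d_K}, 1) ≠ 0`, for `E/ℚ` of
analytic rank one** (Gross–Zagier–Kolyvagin over `ℚ` for `E` and for the twist `E^{d_K}`, of analytic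
rank `0` by modularity; `rank E(K) = rank E(ℚ) + rank E^{d_K}(ℚ)`). No Heegner hypothesis is used; the
same argument as route R1's `IsErratumField.mordellWeilRank_eq_one_and_shaFinite`, stated on raw
hypotheses so that route p2's data (classical Heegner fields) can use it.
[cite: JetchevSkinnerWan2017, §7.4.1 (arXiv:1512.06894 p. 30)] [cite: DokchitserDokchitserAnnals2010, Lemma 4.14 (proof)] -/
theorem mordellWeilRank_baseChange_eq_one_of_twist_ne_zero
    (hGZK : rank_eq_analyticRank_of_analyticRank_le_one) (hnf : exists_isNewformOf)
    (hr : W.analyticRank = 1) (h2 : Module.finrank ℚ K = 2)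
    (hLt : (W.quadraticTwist (NumberField.discr K : ℚ)).entireLFunction 1 ≠ 0) :
    (W.baseChange K).mordellWeilRank = 1 := by
  have hmod : hasEntireLFunction_rat := hasEntireLFunction_rat_of_exists_isNewformOf hnf
  have hD0 : (NumberField.discr K : ℚ) ≠ 0 := by exact_mod_cast NumberField.discr_ne_zero K
  haveI hEt : (W.quadraticTwist (NumberField.discr K : ℚ)).IsElliptic :=
    W.isElliptic_quadraticTwist hD0
  have hrt : (W.quadraticTwist (NumberField.discr K : ℚ)).analyticRank = 0 :=
    ((W.quadraticTwist _).analyticRank_eq_zero_iff_holds (hmod _)).2 hLt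
  obtain ⟨hrankW, -⟩ := hGZK W (le_of_eq hr)
  obtain ⟨hrankt, -⟩ := hGZK (W.quadraticTwist (NumberField.discr K : ℚ)) (by omega)
  rw [mordellWeilRank_baseChange_quadratic_holds W K h2, hrankW, hr, hrankt, hrt]

end Bridges

/-! ### §2 The OPEN half of route p2 at `p ≥ 5`, typed over Castella's frame -/

section Shape

variable (W : WeierstrassCurve ℚ) [W.IsElliptic] [W.IsGloballyMinimal] (p : ℕ) [Fact p.Prime]

/-- **(IMC≥) for Castella's published `L_p(f)`, on route p2's data — OPEN shape, typed.** At every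
datum of `P2OpenInputOnTreeAt W p` (`(E,p)` in X11b, `p ≥ 5`, `ρ̄_{E,p}` onto; `K` imaginary quadratic,
`d_K` odd, `p ∤ d_K`, `p ∤ #𝓞_K^×`, every `ℓ ∣ N_E` split, `L(E^{d_K},1) ≠ 0`; a parametrisation datum
of level `N_E` with `p ∤ c`; `P` its Heegner point, non-torsion; anticyclotomic `(κ, γ)`), for every
newform `f` of `E`, every embedding datum `ι' : ℚ̄_p ≃ ℂ` and infinite place `w₀`, and every frame
`(Ω_K, Ω_p, L)` with `IsBDPLFunction ι' 𝔭_{ι'} κ γ f Ω_K Ω_p L` at the induced prime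
`𝔭_{ι'} = primeOfEmbeddingDatum p ι' w₀.embedding`: the ONE-SIDED divisibility
`Ch_Λ(X_ac^∅(E[p^∞]))·R₀⟦T⟧ ⊆ (L)` — the erratum's display (2.4) (p. 4) TRANSCRIBED to classical
data. The `p ≥ 5` twin of team x11b3's `Three.IMCDivAt₃`; the one-sided half of route R1's
`R1.IMCEqOnTree`. A predicate on `(W, p)`; NEVER a theorem in this cell; every result using it is
CONDITIONAL. OWNER'S STATUS NOTES (multr1-p2 gen 29, see the file docstring): **REFUTED AS STATED**
(`P2.not_imcDivOnTree_of_facts`, gen 26: the degenerate frame `(Ω_K, L) = (0, 0)`; corrected shape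
`P2.IMCDivAllUnrFramesOnTree` with `Ω_K ≠ 0`), kept in place for its consumers; and **NO announced
derivation at these classical data** even for the corrected shape — the erratum's "(2.4) ⇐ [FW21,
Thm. 4.41]" needs a prime `q ∥ N` NOT split in `K` (typed at erratum data as
`P2.IMCDivIntFrameAtErratumData`); the former claim badge naming the erratum is withdrawn.
[cite: Castella2018Erratum, (2.4) (p. 4) (display transcribed to classical data; its derivation there assumes a prime of N non-split in K; shape only; nothing asserted; refuted as a ∀-shape over degenerate frames)] -/
def P2.IMCDivOnTree : Prop :=
  ∀ (N : ℕ) [NeZero N] (K : Type) [Field K] [NumberField K]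
    (Dt : ModularParametrizationData W N) (H : HeegnerDatum N (NumberField.discr K)) (ι : K →+* ℂ)
    (P : (W.baseChange K).toAffine.Point),
    ClassX11b W p → 5 ≤ p → Surj W p → W.conductorNorm ℤ = N → IsImaginaryQuadratic K →
    Odd (NumberField.discr K) → ¬ (p : ℤ) ∣ NumberField.discr K → ¬ p ∣ Units.torsionOrder K →
    SatisfiesHeegnerHypothesis N K →
    (W.quadraticTwist (NumberField.discr K : ℚ)).entireLFunction 1 ≠ 0 →
    WeierstrassCurve.Affine.Point.map ι.toRatAlgHom P = heegnerPointComplex Dt H →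
    ¬ (p : ℤ) ∣ Dt.c → ¬ IsOfFinAddOrder P →
    ∀ (κ : ZpExtension K p), κ.IsAnticyclotomic →
      ∀ (γ : Field.absoluteGaloisGroup K) [Fact (κ.IsTopGenerator γ)]
        (f : CuspForm (CongruenceSubgroup.Gamma0 N) 2), IsNewformOf W f →
        ∀ (ι' : PadicAlgCl p ≃+* ℂ) (w₀ : InfinitePlace K) (ΩK : ℂ) (Ωp : (unrIntegers p)ˣ)
          (L : UnrSeries p),
          IsBDPLFunction ι' (primeOfEmbeddingDatum p ι' w₀.embedding) κ γ f ΩK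
            ((Ωp : unrIntegers p) : ℂ_[p]) L →
          (XAc.charIdeal (W.baseChange K) p κ (primeOfEmbeddingDatum p ι' w₀.embedding) ∅ γ).map
              (PowerSeries.map (toUnr p)) ≤ Ideal.span {L}

variable {W p} in
omit [W.IsElliptic] [W.IsGloballyMinimal] in
/-- Route R1's EQUALITY half implies route p2's divisibility half at a common datum shape: here only
the pointwise remark `(I = (L)) → (I ≤ (L))` used by both. [folklore] -/
theorem le_span_of_map_eq {K : Type} [Field K] [NumberField K] {κ : ZpExtension K p}
    {𝔭 : HeightOneSpectrum (𝓞 K)} {γ : Field.absoluteGaloisGroup K} [Fact (κ.IsTopGenerator γ)]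
    {L : UnrSeries p} (h : R1.IMCEqOnTreeAt W p κ 𝔭 γ L) :
    (XAc.charIdeal (W.baseChange K) p κ 𝔭 ∅ γ).map (PowerSeries.map (toUnr p)) ≤ Ideal.span {L} :=
  le_of_eq h

end Shape

/-! ### §3 Route p2's open input from the published fact and the divisibility half -/

section ClassLevel

variable {W : WeierstrassCurve ℚ} [W.IsElliptic] [W.IsGloballyMinimal] {p : ℕ} [Fact p.Prime]

/-- **Route p2's open input FROM PRINT ∧ (2.4), on a semistable pair at `p ≥ 5`.** Given the
PUBLISHED facts `h32` (Cas18 Thms. 3.1–3.2), `hnf` (modularity), `hGZK`, the control identity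
`P2ControlOnTreeAt W p` (PUB shape; a THEOREM on the Locus, `p2ControlOnTreeAt_of_locus`), ONE
embedding datum `ι₀`, a SEMISTABLE pair, and the ONE TYPED OPEN half `P2.IMCDivOnTree W p`:
`P2OpenInputOnTreeAt W p` at every datum, every anticyclotomic `(κ, γ)` and every degree-one `𝔭 ∣ p`
with THE embedding `embAt K p 𝔭`. CONDITIONAL on the open half.
[cite: Castella2018, Thms. 2.3, 3.1, 3.2 and §5 (arXiv:1704.06608 pp. 5, 9, 12)]
[cite: Castella2018Erratum, (2.4) and Thm. 1.1 (pp. 1, 4)] -/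
theorem P2.openInputOnTreeAt_of_imcDiv (h32 : thm32_exists_isBDPLFunction_valueAtOne)
    (hnf : exists_isNewformOf) (hGZK : rank_eq_analyticRank_of_analyticRank_le_one)
    (hC : P2ControlOnTreeAt W p) (ι₀ : PadicAlgCl p ≃+* ℂ) (hss : Semistable W)
    (h3 : P2.IMCDivOnTree W p) : P2OpenInputOnTreeAt W p := by
  intro N _ K _ _ Dt H ιK P hX h5 hs hN hK hodd hpd hμ hHN hLt hP hc hPinf κ hκ γ _ 𝔭 h𝔭 he hf
  obtain ⟨n, hn, -⟩ := hC N K Dt H ιK P hX h5 hs hN hK hodd hpd hμ hHN hLt hP hc hPinf κ hκ γ 𝔭 h𝔭 he hf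
  have h3' := h3 N K Dt H ιK P hX h5 hs hN hK hodd hpd hμ hHN hLt hP hc hPinf κ hκ γ
  subst hN
  obtain ⟨hr, -, hmult, hirr⟩ := hX
  obtain ⟨w₀⟩ := (inferInstance : Nonempty (InfinitePlace K))
  have hp2 : p ≠ 2 := by omega
  have hpN : p ∣ W.conductorNorm ℤ := dvd_conductorNorm_of_mult hmult
  -- `rank_ℤ E(K) = 1` (Gross–Zagier–Kolyvagin)
  have hrk : (W.baseChange K).mordellWeilRank = 1 :=
    mordellWeilRank_baseChange_eq_one_of_twist_ne_zero W hGZK hnf hr hK.1 hLt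
  -- the datum's complex embedding is `w₀.embedding ∘ τ` for some `τ ∈ Gal(K/ℚ)`, `τ² = 1`
  haveI : IsGalois ℚ K := by
    haveI : Algebra.IsQuadraticExtension ℚ K := ⟨hK.1⟩
    infer_instance
  obtain ⟨σ, hσ⟩ := ComplexEmbedding.exists_comp_symm_eq_of_comp_eq (k := ℚ) w₀.embedding ιK
    (by ext x; simp)
  set τ : K →+* K := ((σ.symm : K ≃ₐ[ℚ] K) : K →+* K) with hτdef
  have hτ : ∀ x, τ (τ x) = x := by
    intro x
    have hcard : Nat.card (K ≃ₐ[ℚ] K) = 2 := by rw [IsGalois.card_aut_eq_finrank, hK.1]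
    have hsq : σ.symm * σ.symm = 1 := by
      have h := pow_card_eq_one' (G := K ≃ₐ[ℚ] K) (x := σ.symm)
      rwa [hcard, pow_two] at h
    have := congrArg (fun g : K ≃ₐ[ℚ] K ↦ g x) hsq
    simpa [hτdef, AlgEquiv.mul_apply] using this
  -- the Galois conjugate `P' = τ_* P` is the Heegner point read through `w₀.embedding`
  set P' := WeierstrassCurve.Affine.Point.map τ.toRatAlgHom P with hP'def
  have hP' : WeierstrassCurve.Affine.Point.map w₀.embedding.toRatAlgHom P' =
      heegnerPointComplex Dt H := by
    rw [hP'def, WeierstrassCurve.Affine.Point.map_map]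
    have hcomp : w₀.embedding.toRatAlgHom.comp τ.toRatAlgHom = ιK.toRatAlgHom := by
      apply AlgHom.ext
      intro x
      have := RingHom.congr_fun hσ x
      simpa [hτdef] using this
    rw [hcomp]
    exact hP
  have hlog : ∀ e : K →+* ℚ_[p], padicLogOrd W p e P' = padicLogOrd W p e P := fun e ↦
    R1.padicLogOrd_map_eq_of_rank_one W p e P hp2 τ hτ hrk hPinf
  -- THE embedding at `𝔭` induces `𝔭`
  have hemb : ∀ k : 𝓞 K, k ∈ 𝔭.asIdeal ↔ ‖embAt K p 𝔭 h𝔭 he hf (k : K)‖ < 1 :=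
    mem_asIdeal_iff_norm_embAt_lt_one 𝔭 h𝔭 he hf
  -- every degree-one prime above `p` is induced by `ι₀` or by `ι₀ ∘ conj`
  have key : ∀ ι' : PadicAlgCl p ≃+* ℂ, 𝔭 = primeOfEmbeddingDatum p ι' w₀.embedding →
      IMCLowerWaldspurgerOnTreeAt p κ 𝔭 γ (embAt K p 𝔭 h𝔭 he hf) P := by
    intro ι' h𝔭eq
    subst h𝔭eq
    obtain ⟨ΩK, Ωp, L, -, hL, u, hu⟩ :=
      R1.exists_frame_bdpValueAtOneOnTreeAt_of_satisfiesHeegnerHypothesis h32 ι' Dt H h5 hss hirr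
        hpN hK hHN hc w₀ hP' κ hκ γ Fact.out hemb
    refine imcLowerWaldspurgerOnTreeAt_of_padicLogOrd_eq W p _ (hlog _) ?_
    exact imcLowerWaldspurgerOnTreeAt_of_value_of_dvd hn
      (h3' Dt.f Dt.isNewformOf ι' w₀ ΩK Ωp L hL) u (W.LFunction p) hu
  rcases eq_primeOfEmbeddingDatum_or_eq_trans_starRingAut p ι₀ hK w₀ h𝔭 with h | h
  · exact key ι₀ h
  · exact key _ h

/-- The same WITHOUT the auxiliary embedding datum (Steinitz: `ℚ̄_p ≃ ℂ`,
`PadicAlgCl.nonempty_ringEquiv_complex`). CONDITIONAL on the open half.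
[cite: Castella2018, Thms. 3.1–3.2 (arXiv:1704.06608 p. 9)] [cite: Castella2018Erratum, (2.4) (p. 4)] -/
theorem P2.openInputOnTreeAt_of_imcDiv' (h32 : thm32_exists_isBDPLFunction_valueAtOne)
    (hnf : exists_isNewformOf) (hGZK : rank_eq_analyticRank_of_analyticRank_le_one)
    (hC : P2ControlOnTreeAt W p) (hss : Semistable W) (h3 : P2.IMCDivOnTree W p) :
    P2OpenInputOnTreeAt W p := by
  obtain ⟨ι₀⟩ := PadicAlgCl.nonempty_ringEquiv_complex p
  exact P2.openInputOnTreeAt_of_imcDiv h32 hnf hGZK hC ι₀ hss h3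

omit [W.IsElliptic] [W.IsGloballyMinimal] in
/-- **Route R1's equality half implies route p2's divisibility half** on route p2's data shape:
trivial pointwise (`=` ⟹ `≤`), recorded so that either refereeing outcome (equality or divisibility
for Castella's `L_p(f)`) can be routed to route p2. (The two class-level shapes quantify over
DIFFERENT data — erratum fields vs classical Heegner fields — so there is no class-level implication
between `R1.IMCEqOnTree` and `P2.IMCDivOnTree`; this is the shared pointwise core.) [folklore] -/
theorem P2.imcDivOnTree_pointwise_of_eq {K : Type} [Field K] [NumberField K] {κ : ZpExtension K p}
    {𝔭 : HeightOneSpectrum (𝓞 K)} {γ : Field.absoluteGaloisGroup K} [Fact (κ.IsTopGenerator γ)]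
    {L : UnrSeries p} (h : R1.IMCEqOnTreeAt W p κ 𝔭 γ L) :
    (XAc.charIdeal (W.baseChange K) p κ 𝔭 ∅ γ).map (PowerSeries.map (toUnr p)) ≤ Ideal.span {L} :=
  le_span_of_map_eq h

/-! ### §4 Record for the owner of route p2: semistable Locus pairs -/

/-- **Route p2 — `BSD_p` on SEMISTABLE Locus pairs from print + cited + ONE OPEN divisibility.** For
every globally minimal SEMISTABLE elliptic `W/ℚ` and prime `p` with `(E,p)` in X11b, `p ≥ 5`, `E[p]`
ramified at some multiplicative prime `≠ p` (`Ram`) and `p ∤ ∏_ℓ c_ℓ(E)` (the Locus): `BSD(E,p)`, from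
the PUBLISHED named facts of multr1-p2's tightness theorem `P2.openInputOnTreeAt_iff_bsdp_of_locus`
(`hGZ` Gross–Zagier, `hKo` Kolyvagin, `hB` Kolyvagin 1990, `hSk` Skinner 2016 Thm. C, `hWu`, `hGZK`,
`hnf` modularity, `hHL` Hoffstein–Luo, `hMaz` Mazur) + `h32` (Castella 2018 Thms. 3.1–3.2), the CITED
cohomological facts `hPTs hPT hPT2 hEP hcd` (through x11b3-p9's `p2ControlOnTreeAt_of_locus`), and the
ONE OPEN input `P2.IMCDivOnTree W p` = the divisibility (2.4) for Castella's published `L_p(f)`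
(transcribed to classical data — NO announced derivation there, and REFUTED as a ∀-shape over the
degenerate frame, gen-29 status notes under §2: read this record with the corrected shape
`P2.IMCDivAllUnrFramesOnTree` / gen 27's `P2.bsdp_of_semistable_of_imcDivSomeFrameAtGivenField`
instead). CONDITIONAL; deletes nothing; X11b stays
CONSTRUCTION-SHAPED; no label change; the record belongs to route p2's owner (multr1-p2).
[cite: Castella2018, §5 (arXiv:1704.06608 p. 12)] [cite: Castella2018Erratum, (2.4), Thm. 1.1 (pp. 1, 4)] -/
theorem P2.bsdp_of_imcDiv_of_locus
    (hGZ : ∀ (N : ℕ) [NeZero N] (W : WeierstrassCurve ℚ) (K : Type) [Field K] [NumberField K],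
      gross_zagier N W K)
    (hKo : ∀ (N : ℕ) [NeZero N] (W : WeierstrassCurve ℚ) (K : Type) [Field K] [NumberField K],
      kolyvagin N W K)
    (hB : ∀ (N : ℕ) [NeZero N] (W : WeierstrassCurve ℚ) (K : Type) [Field K] [NumberField K],
      Kolyvagin1990_padicValNat_card_sha_le N W K)
    (hSk : Skinner2016.thmC_padicValRat_bsd_rank_zero) (hWu : sha_dvd_analyticSha)
    (hGZK : rank_eq_analyticRank_of_analyticRank_le_one) (hnf : exists_isNewformOf)
    (hHL : HoffsteinLuo1997_exists_twist_L_one_ne_zero)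
    (hMaz : mazur_not_dvd_maninConstant_of_odd) (h32 : thm32_exists_isBDPLFunction_valueAtOne)
    (hPTs : ∀ (K : Type) [Field K] [NumberField K], poitouTate_sum_localTatePairing_eq_zero K)
    (hPT : ∀ (K : Type) [Field K] [NumberField K], poitouTate_selmerStructure_duality K)
    (hPT2 : ∀ (K : Type) [Field K] [NumberField K], poitouTate_sha_tateDual K)
    (hEP : ∀ (K : Type) [Field K] [NumberField K] (v : HeightOneSpectrum (𝓞 K)),
      localEulerPoincareCharacteristic (v.adicCompletion K))
    (hcd : fieldCdLE_two_of_numberField)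
    (hss : Semistable W) (h3 : P2.IMCDivOnTree W p)
    (hX : ClassX11b W p) (hp5 : 5 ≤ p) (hram : Ram W p) (htam : ¬ p ∣ W.tamagawaProduct) :
    BSDp W p :=
  (P2.openInputOnTreeAt_iff_bsdp_of_locus_citedControl (W := W) (p := p) hGZ hKo hB hSk hWu hGZK hnf
      hHL hMaz hPTs hPT hPT2 hEP hcd hX hp5 hram htam).mp
    (P2.openInputOnTreeAt_of_imcDiv' h32 hnf hGZK
      (p2ControlOnTreeAt_of_locus W p hKo hPT hPT2 hEP hcd hX hram htam) hss h3)

end ClassLevel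

end Summit.BirchSwinnertonDyer.Rank1Residual.X11b

end
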